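import Summits.PneNP.PneNP.Theorems.ChebyshevTracialDesignJuntaTimesSquare
import Summits.PneNP.PneNP.Theorems.ChebyshevTracialDesignDegreeOneFrobeniusMass
import HarnessLib

/-!
# Cell pnp-psdrank, route `ChebyshevTracialDesign`: THE 𝒜₁ RUNG WITH JUNTA AMPLITUDES IS UNCONDITIONAL — CG_1 holds for junta masks (explicit `ε`),
# hence `Σ W f tr(B_UB_UᵀY_M) ≤ ε·|PM|·r·n(n−1)/(t(n−t))` for every homogeneous degree-one contraction factor `B`, every psd contraction `Y`, EVERY
# dimension `r` (crux `TracialDecayExp20`, stmt-PneNP-19878)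

Brick 115 (prover g20; MEMO-23 §2(e)). MEMO-21 §3(b) and bricks 106/108 built the first r-free rung above NTF by name: CG_1 («per matching,
`Σ_U W(U,M) f(U)(Σ_pg_px_p)² ≤ ε_M Σ_pg_p²` for every `g`») ⟹ the crux's value on the amplitude class `𝒜₁ = {X_U = f(U)·B_UB_Uᵀ : B_U = Σ_px_pβ_p}` is
`≤ (Σ_Mε_M₊)·r·n(n−1)/(t(n−t))` (`value_amplitudeOne_le_of_CG1_dim`). Brick 114 (`juntaTimesSquare_le_single`, `d = 1`) DISCHARGES CG_1 for JUNTA masks: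
* §1 `linear_as_containment`, `linear_coeff_mass_le` (a linear form as a degree-1 containment combination, coefficient mass `≤ Σ|g_p|`),
  **`CG1_of_junta`**: for an exact design `(n,t,T,D,B_v,C,w)`, a nonnegative `J`-junta mask `f ≤ Λ_f` with `2(|J|+2)+1 ≤ t`, every `M` and `g`:
  `Σ_U W(U,M)f(U)(Σ_pg_px_p)² ≤ ε·Σ_pg_p²`, `ε = |PM|⁻¹·B_v·C(T,D+1)·nΛ_f·4^{|J|+2}·C(|J|+2,D+1)(D+1)!N^{|J|+1−D}/[N]_{|J|+2}` (`(Σ|g_p|)² ≤ nΣg_p²`).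
* §2 **`value_juntaAmplitudeOne_le`**: with `B_UB_Uᵀ ⪯ I` on the `t`-cuts and `0 ⪯ Y_M ⪯ I`:
  `Σ_UΣ_M W(U,M)·f(U)·tr(B_UB_UᵀY_M) ≤ B_v·C(T,D+1)·nΛ_f·4^{|J|+2}C(|J|+2,D+1)(D+1)!N^{|J|+1−D}/[N]_{|J|+2} · r·n(n−1)/(t(n−t))` — the dimension enters linearly;
  in the balanced Chebyshev regime the normalised value is `≲ 20·(16n/3)·nΛ_f·4^{|J|+2}·2^{|J|+2}(8(|J|+2)/√n)^{dq n+1} = n^{−(dq n+1)/4 + 2 + O(|J|/ln n)}` at EVERY `r`.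
READING: the 𝒜₁ rung is now unconditional for junta amplitudes of size `O(dq n)` (and trivially contains N1's `f ≡ 1` case); its open part is the
non-junta amplitude `f`, i.e. CG_1 for spread masks (MEMO-23 §5 prover (2): «tilted NTF»).
[cite: GriblingDelaatLaurent2019, §5] [cite: Rothvoss2017, §2 (PDF p. 6)] [cite: Grigoriev2001, Lemma 1.4 (PDF p. 8)] [cite: BrietDadushPokutta2014, Thm. 6 (§3)]
[cite: Agarwal2000DifferenceEquations, Remark 1.8.1 (1.8.8)]
Stature: support/instrument (kernel lane, no defs, axioms standard). WHAT THIS IS NOT: nothing on non-junta amplitudes or on factors of degree `> 1`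
with amplitudes (brick 114 gives the scalar form for any degree), no proof or refutation of `TracialDecayExp20`, nothing on psd rank of P_PM(K_n),
no P-vs-NP content. Supports stmt-PneNP-19878.
-/

set_option linter.dupNamespace false -- `Summit.PneNP.PneNP.…`: summit = sub-problem (D-0017)

noncomputable section

namespace Summit.PneNP.PneNP.Theorems.ChebyshevTracialDesignJuntaAmplitudeOne

open Finset Matrix Polynomial Literature.Barriers.PneNP Literature.Combinatorics.Optimization
open Summit.PneNP.PneNP.Theorems.ChebyshevTracialDesignJuntaTimesSquare (juntaTimesSquare_le_single)
open Summit.PneNP.PneNP.Theorems.ChebyshevTracialDesignDegreeOneFrobeniusMass (value_amplitudeOne_le_of_CG1_dim)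

variable {n : ℕ}

/-! ### §1 CG_1 holds for junta masks, per matching, with an explicit ε -/

/-- A linear form `Σ_p g_p x_p` as a degree-`1` containment combination: with `α(A') = Σ_p [A' = {p}]·g_p`,
`Σ_{|A'| ≤ 1} α(A')·1[A' ⊆ U] = Σ_p g_p·1[p ∈ U]`, and `Σ_{A'} |α(A')| ≤ Σ_p |g_p|`. [folklore] -/
theorem linear_as_containment (g : Fin n → ℝ) (U : Finset (Fin n)) :
    (∑ A' : {A' : Finset (Fin n) // A'.card ≤ 1}, (∑ p, if A'.1 = {p} then g p else 0) * (if A'.1 ⊆ U then (1 : ℝ) else 0)) =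
      ∑ p, g p * (if p ∈ U then (1 : ℝ) else 0) := by
  classical
  rw [show (∑ A' : {A' : Finset (Fin n) // A'.card ≤ 1}, (∑ p, if A'.1 = {p} then g p else 0) * (if A'.1 ⊆ U then (1 : ℝ) else 0)) =
      ∑ p, ∑ A' : {A' : Finset (Fin n) // A'.card ≤ 1}, (if A'.1 = {p} then g p else 0) * (if A'.1 ⊆ U then (1 : ℝ) else 0) by
    rw [sum_comm]; exact sum_congr rfl fun A' _ => by rw [sum_mul]]
  refine sum_congr rfl fun p _ => ?_
  rw [Finset.sum_eq_single ⟨{p}, by simp⟩]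
  · simp
  · intro A' _ hA'
    have : A'.1 ≠ {p} := fun h => hA' (Subtype.ext h)
    simp [this]
  · intro h; exact absurd (mem_univ _) h

/-- The coefficient mass of the linear form: `Σ_{A'} |α(A')| ≤ Σ_p |g_p|`. [folklore] -/
theorem linear_coeff_mass_le (g : Fin n → ℝ) :
    ∑ A' : {A' : Finset (Fin n) // A'.card ≤ 1}, |∑ p, if A'.1 = {p} then g p else (0 : ℝ)| ≤ ∑ p, |g p| := by
  classical
  calc ∑ A' : {A' : Finset (Fin n) // A'.card ≤ 1}, |∑ p, if A'.1 = {p} then g p else (0 : ℝ)|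
      ≤ ∑ A' : {A' : Finset (Fin n) // A'.card ≤ 1}, ∑ p, |if A'.1 = {p} then g p else (0 : ℝ)| :=
        sum_le_sum fun A' _ => abs_sum_le_sum_abs _ _
    _ = ∑ p, ∑ A' : {A' : Finset (Fin n) // A'.card ≤ 1}, |if A'.1 = {p} then g p else (0 : ℝ)| := sum_comm
    _ = ∑ p, |g p| := sum_congr rfl fun p _ => by
        rw [Finset.sum_eq_single ⟨{p}, by simp⟩]
        · simp
        · intro A' _ hA'
          have : A'.1 ≠ {p} := fun h => hA' (Subtype.ext h)
          simp [this]
        · intro h; exact absurd (mem_univ _) h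

/-- **CG_1 FOR JUNTA MASKS (unconditional, per matching, explicit `ε`).** For an exact design `(n,t,T,D,B_v,C,w)`, a nonnegative `J`-junta mask `f ≤ Λ_f`
with `2(|J|+2)+1 ≤ t`, every matching `M` and every `g : Fin n → ℝ`:
`Σ_U W(U,M)·f(U)·(Σ_p g_px_p)² ≤ ε·Σ_p g_p²` with `ε = |PM|⁻¹·B_v·C(T,D+1)·n·Λ_f·4^{|J|+2}·C(|J|+2,D+1)(D+1)!·N^{|J|+1−D}/[N]_{|J|+2}` (brick 114 with `d = 1` and
`(Σ|g_p|)² ≤ n·Σg_p²`). This is the hypothesis (CG_1) of bricks 106/108 (MEMO-21 §3(b)), discharged on junta masks.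
[cite: Grigoriev2001, Lemma 1.4 (PDF p. 8)] [cite: Rothvoss2017, §2 (PDF p. 6)] [cite: Agarwal2000DifferenceEquations, Remark 1.8.1 (1.8.8)] -/
theorem CG1_of_junta {t T D : ℕ} {Bv : ℝ} {C : Finset ℕ} {w : ℕ → ℝ} (hdes : IsExactDesign n t T D Bv C w)
    (J : Finset (Fin n)) (hJt : 2 * (J.card + 2) + 1 ≤ t)
    (f : OddSet n → ℝ) (hf : ∀ U U' : OddSet n, U.1 ∩ J = U'.1 ∩ J → f U = f U') {Λf : ℝ} (hf0 : ∀ U, 0 ≤ f U) (hfΛ : ∀ U, f U ≤ Λf)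
    (M : PMatch n) (g : Fin n → ℝ) :
    ∑ U : OddSet n, levelWeight n t C w U M * (f U * (∑ p, g p * (if p ∈ U.1 then (1 : ℝ) else 0)) ^ 2) ≤
      ((Fintype.card (PMatch n) : ℝ)⁻¹ * (Bv * ((T.choose (D + 1) : ℕ) : ℝ) * ((n : ℝ) * Λf * (4 : ℝ) ^ (J.card + 2) *
        ((((J.card + 2).choose (D + 1) : ℕ) : ℝ) * ((D + 1).factorial : ℝ) * (((n / 2 : ℕ) : ℝ)) ^ (J.card + 2 - (D + 1)) /
          ((n / 2).descFactorial (J.card + 2) : ℝ))))) * ∑ p, g p ^ 2 := by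
  classical
  set α : {A' : Finset (Fin n) // A'.card ≤ 1} → ℝ := fun A' => ∑ p, if A'.1 = {p} then g p else 0 with hα
  have h := juntaTimesSquare_le_single hdes M J (d := 1) (by omega) f hf hf0 hfΛ α
  have hrw : ∀ U : OddSet n, (∑ A' : {A' : Finset (Fin n) // A'.card ≤ 1}, α A' * (if A'.1 ⊆ U.1 then (1 : ℝ) else 0)) =
      ∑ p, g p * (if p ∈ U.1 then (1 : ℝ) else 0) := fun U => linear_as_containment g U.1
  simp_rw [hrw] at h
  refine h.trans ?_
  have hB : 0 ≤ Bv := (sum_nonneg fun c _ => abs_nonneg (w c)).trans hdes.2.2.2.2.2.2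
  have hΛf : 0 ≤ Λf := by
    have htn : 2 * t + 2 ≤ n := hdes.2.1
    have hodd1 : Odd (({(⟨0, by omega⟩ : Fin n)} : Finset (Fin n)).card) := by simp
    exact (hf0 ⟨_, hodd1⟩).trans (hfΛ ⟨_, hodd1⟩)
  have hmass : (∑ A', |α A'|) ^ 2 ≤ (n : ℝ) * ∑ p, g p ^ 2 := by
    have h1 : ∑ A', |α A'| ≤ ∑ p, |g p| := linear_coeff_mass_le g
    have h2 : (∑ p, |g p|) ^ 2 ≤ (Finset.univ : Finset (Fin n)).card * ∑ p, |g p| ^ 2 := sq_sum_le_card_mul_sum_sq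
    rw [card_univ, Fintype.card_fin] at h2
    simp only [sq_abs] at h2
    exact (pow_le_pow_left₀ (sum_nonneg fun _ _ => abs_nonneg _) h1 2).trans h2
  have hrest : 0 ≤ Λf * (4 : ℝ) ^ (J.card + 2) *
      ((((J.card + 2).choose (D + 1) : ℕ) : ℝ) * ((D + 1).factorial : ℝ) * (((n / 2 : ℕ) : ℝ)) ^ (J.card + 2 - (D + 1)) /
        ((n / 2).descFactorial (J.card + 2) : ℝ)) := by positivity
  calc (Fintype.card (PMatch n) : ℝ)⁻¹ * (Bv * ((T.choose (D + 1) : ℕ) : ℝ) * ((∑ A', |α A'|) ^ 2 * Λf * (4 : ℝ) ^ (J.card + 2) *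
        ((((J.card + 2).choose (D + 1) : ℕ) : ℝ) * ((D + 1).factorial : ℝ) * (((n / 2 : ℕ) : ℝ)) ^ (J.card + 2 - (D + 1)) /
          ((n / 2).descFactorial (J.card + 2) : ℝ))))
      = ((Fintype.card (PMatch n) : ℝ)⁻¹ * (Bv * ((T.choose (D + 1) : ℕ) : ℝ))) * (Λf * (4 : ℝ) ^ (J.card + 2) *
        ((((J.card + 2).choose (D + 1) : ℕ) : ℝ) * ((D + 1).factorial : ℝ) * (((n / 2 : ℕ) : ℝ)) ^ (J.card + 2 - (D + 1)) /
          ((n / 2).descFactorial (J.card + 2) : ℝ))) * (∑ A', |α A'|) ^ 2 := by ring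
    _ ≤ ((Fintype.card (PMatch n) : ℝ)⁻¹ * (Bv * ((T.choose (D + 1) : ℕ) : ℝ))) * (Λf * (4 : ℝ) ^ (J.card + 2) *
        ((((J.card + 2).choose (D + 1) : ℕ) : ℝ) * ((D + 1).factorial : ℝ) * (((n / 2 : ℕ) : ℝ)) ^ (J.card + 2 - (D + 1)) /
          ((n / 2).descFactorial (J.card + 2) : ℝ))) * ((n : ℝ) * ∑ p, g p ^ 2) :=
        mul_le_mul_of_nonneg_left hmass (by positivity)
    _ = _ := by ring

/-! ### §2 The amplitude-one class with junta amplitudes, every dimension — unconditionally -/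

/-- **THE 𝒜₁ RUNG WITH JUNTA AMPLITUDES IS UNCONDITIONAL.** For an exact design `(n,t,T,D,B_v,C,w)`, a nonnegative `J`-junta mask `f ≤ Λ_f`
(`2(|J|+2)+1 ≤ t`), a homogeneous degree-one factor `B_U = Σ_p x_pβ_p` (`β_p ∈ ℝ^{r×m}`, ANY `r, m`) with `B_UB_Uᵀ ⪯ I` on the `t`-cuts, and ANY psd contraction
field `Y` on the matchings:
`Σ_U Σ_M W(U,M)·f(U)·tr(B_UB_UᵀY_M) ≤ B_v·C(T,D+1)·nΛ_f·4^{|J|+2}·C(|J|+2,D+1)(D+1)!·N^{|J|+1−D}/[N]_{|J|+2} · r·n(n−1)/(t(n−t))` — bricks 106/108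
(`value_amplitudeOne_le_of_CG1_dim`: CG_1 ⟹ crux on 𝒜₁) composed with `CG1_of_junta`: the dimension enters linearly, so the NORMALISED tracial value of
the amplitude class `𝒜₁` with junta amplitudes of size `O(dq n)` is super-polynomially small at EVERY dimension `r`, tight or not.
[cite: GriblingDelaatLaurent2019, §5] [cite: Rothvoss2017, §2 (PDF p. 6)] [cite: Grigoriev2001, Lemma 1.4 (PDF p. 8)] [cite: BrietDadushPokutta2014, Thm. 6 (§3)] -/
theorem value_juntaAmplitudeOne_le {t T D : ℕ} {Bv : ℝ} {C : Finset ℕ} {w : ℕ → ℝ} (hdes : IsExactDesign n t T D Bv C w)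
    (J : Finset (Fin n)) (hJt : 2 * (J.card + 2) + 1 ≤ t)
    (f : OddSet n → ℝ) (hf : ∀ U U' : OddSet n, U.1 ∩ J = U'.1 ∩ J → f U = f U') {Λf : ℝ} (hf0 : ∀ U, 0 ≤ f U) (hfΛ : ∀ U, f U ≤ Λf)
    {r m : ℕ} (β : Fin n → Matrix (Fin r) (Fin m) ℝ)
    (hB : ∀ U : OddSet n, U.1.card = t →
      (1 - (∑ p, (if p ∈ U.1 then (1 : ℝ) else 0) • β p) * (∑ p, (if p ∈ U.1 then (1 : ℝ) else 0) • β p)ᵀ).PosSemidef)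
    (Y : PMatch n → Matrix (Fin r) (Fin r) ℝ) (hY : ∀ M, (Y M).PosSemidef ∧ (1 - Y M).PosSemidef) :
    ∑ U : OddSet n, ∑ M : PMatch n, levelWeight n t C w U M *
        (f U * ((∑ p, (if p ∈ U.1 then (1 : ℝ) else 0) • β p) * (∑ p, (if p ∈ U.1 then (1 : ℝ) else 0) • β p)ᵀ * Y M).trace) ≤
      (Bv * ((T.choose (D + 1) : ℕ) : ℝ) * ((n : ℝ) * Λf * (4 : ℝ) ^ (J.card + 2) *
        ((((J.card + 2).choose (D + 1) : ℕ) : ℝ) * ((D + 1).factorial : ℝ) * (((n / 2 : ℕ) : ℝ)) ^ (J.card + 2 - (D + 1)) /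
          ((n / 2).descFactorial (J.card + 2) : ℝ)))) * ((r : ℝ) * ((n : ℝ) * ((n : ℝ) - 1)) / ((t : ℝ) * ((n : ℝ) - t))) := by
  classical
  have ht : Odd t := hdes.1
  have htn : 2 * t + 2 ≤ n := hdes.2.1
  have ht0 : 0 < t := by omega
  have htn' : t < n := by omega
  -- a `t`-cut exists
  obtain ⟨c₀, hc₀⟩ := nonempty_of_exact hdes.exact
  obtain ⟨q₀, hq₀⟩ := (hdes.2.2.2.1 c₀ hc₀).2.2.2
  have hT : 0 < (univ.filter fun U : OddSet n => U.1.card = t).card :=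
    card_pos.2 ⟨q₀.1, mem_filter.2 ⟨mem_univ _, (mem_Qset_iff.1 hq₀).1⟩⟩
  set ε : ℝ := (Fintype.card (PMatch n) : ℝ)⁻¹ * (Bv * ((T.choose (D + 1) : ℕ) : ℝ) * ((n : ℝ) * Λf * (4 : ℝ) ^ (J.card + 2) *
    ((((J.card + 2).choose (D + 1) : ℕ) : ℝ) * ((D + 1).factorial : ℝ) * (((n / 2 : ℕ) : ℝ)) ^ (J.card + 2 - (D + 1)) /
      ((n / 2).descFactorial (J.card + 2) : ℝ)))) with hε
  have hB0 : 0 ≤ Bv := (sum_nonneg fun c _ => abs_nonneg (w c)).trans hdes.2.2.2.2.2.2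
  have hΛf : 0 ≤ Λf := (hf0 q₀.1).trans (hfΛ q₀.1)
  have hε0 : 0 ≤ ε := by rw [hε]; positivity
  have h := value_amplitudeOne_le_of_CG1_dim ht0 htn' hT (levelWeight n t C w) f β hB Y hY (fun _ => ε)
    (fun M g => CG1_of_junta hdes J hJt f hf hf0 hfΛ M g)
  refine h.trans (le_of_eq ?_)
  rw [sum_const, card_univ, max_eq_left hε0, nsmul_eq_mul, hε]
  have hPM : (Fintype.card (PMatch n) : ℝ) ≠ 0 := by
    have : 0 < Fintype.card (PMatch n) := Fintype.card_pos_iff.2 ⟨q₀.2⟩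
    exact_mod_cast this.ne'
  rw [← mul_assoc, mul_inv_cancel₀ hPM, one_mul]

end Summit.PneNP.PneNP.Theorems.ChebyshevTracialDesignJuntaAmplitudeOne
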